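import Literature.GroupTheory.CombinatorialGroupTheory.FibredTranslationCocyclesTwo
import Literature.GroupTheory.CombinatorialGroupTheory.PuncturedSurfaceGroupCusps
import Mathlib.GroupTheory.QuotientGroup.Basic
import Mathlib.Algebra.Group.Subgroup.Pointwise
import Mathlib.GroupTheory.GroupAction.ConjAct
import Mathlib.GroupTheory.Index
import Mathlib.Tactic.Ring
import HarnessLib

/-!
# The loop twist: level homomorphisms of `Γ_{g,r}` that see ONE level node, for the node loop `b_0` of the irreducible nodal degeneration

Topic `Literature/GroupTheory/CombinatorialGroupTheory`; PROOF-ONLY (0 definitions).  Mochizuki, [CombGC], PROOF of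
Prop. 1.2, p. 9, the resp'd (EDGE) case [cite: MochizukiCombGC2007, Prop 1.2 proof p.9] ("by gluing together
appropriate finite étale coverings of the anabelioids `G_v`, `G_e`, one may construct a finite étale covering
`G' → G` with the desired properties"), DISCRETE half at the NODE of the IRREDUCIBLE nodal degeneration:
`Γ_{g,r}` is the HNN extension of the vertex group `⟨b_0, a_0 b_0 a_0⁻¹, a_i, b_i (i ≥ 1), c_j⟩` along the stable
letter `a_0`, and the node group is `⟨b_0⟩` (a NON-separating loop; the cell's irreducible nodal carriers
`PSCIrreducibleNodalOrigin.lean`).  For the CUSPLESS carriers (`r = 0`, or one cusp) no cut-off character separates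
two level nodes over the node; the companion `PuncturedSurfaceGroupNodeTwist.lean` treats the separating node
`∏_{i<g₀}[a_i,b_i]`.

THE TWIST (`exists_levelHom_loopTwist`, `g ≥ 2`).  `N ⊴ Γ` of finite index, `Q = Γ/N`, `M` a group with a
Heisenberg triple `X Y X⁻¹ Y⁻¹ = Z` (`Z` central, `Z^m = 1 ↔ q ∣ m`, `q > [Γ:N]³`) and a commutative subgroup
`C ∋ Y` normalised by `X` (for the Heisenberg group: `⟨Y, Z⟩`).  `Γ` acts on `Q × M`: `b_0` by the fibred
translation with cocycle `W·δ_{π(f₁)⁻¹}`, `W = Z^{ord b̄_{g−1}}` (so `b_0` has holonomy `W^e ≠ 1` around the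
`⟨b̄_0⟩`-orbit of `π(f₁)⁻¹` and trivial holonomy around every other orbit), `a_0` plainly — the block `[a_0, b_0]`
then carries the two opposite charges `W`, `W⁻¹` —, the handle `g − 1` by two SUPERPOSED orbit cocycles
(`FibredTranslationCocyclesTwo.lean`) carrying `W⁻¹`, `W` at the matching points, all other letters plainly; the
surface relator acts trivially and `ψ : N → M` is the action of `N` on the fibre over `1`.
`exists_normal_separating_loopTwist` packages `Ker ψ` in the output shape of the discrete suppliers of
abc-iut-w5-d047's `IsProSigmaCompletion.exists_open_unrSeparating_of_discrete` (`Ha = Hk = ⟨b_0⟩`, `K = ⊥`).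
abc-iut-f-060 (gen 9), row «NODE-RESIDUAL@UNMARKED» of abc-iut-L3-lead γ85; nothing here bears on [IUTchIII]
Cor. 3.12.
-/

namespace Literature.GroupTheory.CombinatorialGroupTheory

/-! ### The loop twist -/

namespace PuncturedSurfaceGroup

open NodeTwist
open scoped Pointwise

variable {g r : ℕ}

/-- **The loop twist** ([CombGC] Prop. 1.2 proof p. 9, discrete form at the NON-separating node `⟨b_0⟩` of
the irreducible nodal degeneration, `g ≥ 2`).  `N ⊴ Γ_{g,r}` of finite index, `f₁ ∈ Γ_{g,r}`, `M` a group with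
a Heisenberg triple `X Y X⁻¹ Y⁻¹ = Z`, `Z` central, `Z^m = 1 ↔ q ∣ m`, `q > [Γ:N]³`, and a commutative subgroup
`C ∋ Y` normalised by `X`.  Then some `ψ : N → M` SEES the level node of `f₁` —
`ψ(f₁ b_0^{[Γ:N]} f₁⁻¹) ≠ 1` — and KILLS every other level node over the node: `ψ(z) = 1` for
`z ∈ f₂⟨b_0⟩f₂⁻¹ ∩ N` whenever `f₁⁻¹ f₂ ∉ ⟨b_0⟩·N`. [cite: MochizukiCombGC2007, Prop 1.2 proof p.9] -/
theorem exists_levelHom_loopTwist (hg : 2 ≤ g)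
    (N : Subgroup (PuncturedSurfaceGroup g r)) [hN : N.Normal] [N.FiniteIndex]
    {M : Type*} [Group M] {X Y Z : M} (hXYZ : X * Y * X⁻¹ * Y⁻¹ = Z) (hZ : Z ∈ Subgroup.center M)
    (C : Subgroup M) (hCc : ∀ y ∈ C, ∀ y' ∈ C, y * y' = y' * y) (hXC : ∀ y ∈ C, X * y * X⁻¹ ∈ C)
    (hYC : Y ∈ C) {q : ℕ} (hZq : ∀ m : ℕ, Z ^ m = 1 ↔ q ∣ m) (hq : N.index ^ 3 < q)
    (f₁ : PuncturedSurfaceGroup g r) :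
    ∃ ψ : N →* M,
      ψ ⟨f₁ * b ⟨0, by omega⟩ ^ N.index * f₁⁻¹, hN.conj_mem _ (Subgroup.pow_index_mem N _) f₁⟩ ≠ 1 ∧
      ∀ f₂ : PuncturedSurfaceGroup g r,
        f₁⁻¹ * f₂ ∉ (Subgroup.zpowers (b (r := r) (⟨0, by omega⟩ : Fin g)) : Set (PuncturedSurfaceGroup g r)) *
            (N : Set (PuncturedSurfaceGroup g r)) →
        ∀ (z : PuncturedSurfaceGroup g r)
          (hz : z ∈ (ConjAct.toConjAct f₂ • Subgroup.zpowers (b (r := r) (⟨0, by omega⟩ : Fin g))) ⊓ N),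
          ψ ⟨z, hz.2⟩ = 1 := by
  classical
  -- indices and words
  have hgpos : 0 < g := by omega
  set i₀ : Fin g := ⟨0, hgpos⟩ with hi₀
  set iL : Fin g := ⟨g - 1, by omega⟩ with hiL
  have hi₀L : i₀ ≠ iL := by
    simp only [hi₀, hiL, ne_eq, Fin.mk.injEq]; omega
  set x : PuncturedSurfaceGroup g r := b i₀ with hxdef
  obtain ⟨w, hw⟩ : ∃ w : Fin g → PuncturedSurfaceGroup g r, ∀ i, w i = a i * b i * (a i)⁻¹ * (b i)⁻¹ :=
    ⟨_, fun _ => rfl⟩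
  have hwfun : (fun i : Fin g => a (r := r) i * b i * (a i)⁻¹ * (b i)⁻¹) = w := funext fun i => (hw i).symm
  have hwc : ((List.finRange g).map w).prod * ((List.finRange r).map fun j : Fin r => c (g := g) j).prod = 1 := by
    rw [← hwfun]; exact comm_prod_mul_cusp_prod_eq_one
  obtain ⟨mid, hmid⟩ : ∃ mid : PuncturedSurfaceGroup g r, mid = ((List.finRange g).map fun i : Fin g =>
      if 1 ≤ (i : ℕ) then (if (i : ℕ) < g - 1 then w i else 1) else 1).prod := ⟨_, rfl⟩
  have hw_split : ((List.finRange g).map w).prod = w i₀ * mid * w iL := by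
    rw [hmid]; exact prod_map_finRange_eq_first_mul_mid_mul_last hg w
  -- the quotient
  set Q := PuncturedSurfaceGroup g r ⧸ N
  set π : PuncturedSurfaceGroup g r →* Q := QuotientGroup.mk' N with hπ
  have hπN : ∀ {y : PuncturedSurfaceGroup g r}, π y = 1 ↔ y ∈ N := fun {y} => by
    rw [hπ, QuotientGroup.mk'_apply, QuotientGroup.eq_one_iff]
  haveI : Finite Q := Subgroup.finite_quotient_of_finiteIndex
  have hcardQ : Nat.card Q = N.index := rfl
  set m := N.index with hm
  have hmpos : 0 < m := Nat.pos_of_ne_zero Subgroup.FiniteIndex.index_ne_zero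
  -- the active letters and the orbit length of the cancelling handle
  set u := π (a i₀) with hu
  set v := π (b i₀) with hv
  set uL := π (a iL) with huL
  set vL := π (b iL) with hvL
  have hπw₀ : π (w i₀) = u * v * u⁻¹ * v⁻¹ := by rw [hw, map_mul, map_mul, map_mul, map_inv, map_inv]
  have hπwL : π (w iL) = uL * vL * uL⁻¹ * vL⁻¹ := by rw [hw, map_mul, map_mul, map_mul, map_inv, map_inv]
  set L := orderOf vL with hL
  have hL_le : L ≤ m := hcardQ ▸ orderOf_le_card
  have hL_pos : 0 < L := (isOfFinOrder_of_finite vL).orderOf_pos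
  -- the charge `W = Z^L` and the two Heisenberg elements realising `W⁻¹`, `W`
  have hq1 : 1 ≤ q := by omega
  set W := Z ^ L with hW
  have hZq1 : Z ^ q = 1 := (hZq q).mpr dvd_rfl
  have hchA : Y ^ 1 * X ^ L * (Y ^ 1)⁻¹ * (X ^ L)⁻¹ = W⁻¹ := by
    rw [pow_comm_pow_eq_of_comm_eq_central hXYZ hZ 1 L, one_mul]
  have hchB : Y ^ (q - 1) * X ^ L * (Y ^ (q - 1))⁻¹ * (X ^ L)⁻¹ = W := by
    rw [pow_comm_pow_eq_of_comm_eq_central hXYZ hZ (q - 1) L, hW]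
    have hexp : (q - 1) * L + L = q * L := by
      obtain ⟨q', hq'⟩ : ∃ q', q = q' + 1 := ⟨q - 1, by omega⟩
      subst hq'
      rw [Nat.add_sub_cancel]
      ring
    have h1 : Z ^ ((q - 1) * L) * Z ^ L = 1 := by rw [← pow_add, hexp, pow_mul, hZq1, one_pow]
    exact inv_eq_of_mul_eq_one_right h1
  have hYA : Y ^ 1 ∈ C := by rw [pow_one]; exact hYC
  have hYB : Y ^ (q - 1) ∈ C := C.pow_mem hYC _
  -- the support points: `p₁` (the level node of `f₁`), the two charges of the loop block, their translates
  set p₁ : Q := π f₁⁻¹ with hp₁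
  set Pp : Q := v * u * p₁ with hPp
  set Pm : Q := v * p₁ with hPm
  set cA : Q := (π (mid * w iL))⁻¹ * Pp with hcA
  set cB : Q := (π (mid * w iL))⁻¹ * Pm with hcB
  -- the two orbit cocycles on the letter `a_{g−1}` and their superposition
  obtain ⟨αA, hαAC, hαA⟩ := exists_orbitCocycle_mem vL (vL * uL⁻¹ * vL⁻¹ * cA) X (Y ^ 1) C hXC hYA
  obtain ⟨αB, hαBC, hαB⟩ := exists_orbitCocycle_mem vL (vL * uL⁻¹ * vL⁻¹ * cB) X (Y ^ (q - 1)) C hXC hYB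
  have hα : ∀ t : Q, αA (vL * t) * αB (vL * t) * X * (αA t * αB t)⁻¹ * X⁻¹ =
      (if t = uL⁻¹ * (vL⁻¹ * cA) then W⁻¹ else 1) * (if t = uL⁻¹ * (vL⁻¹ * cB) then W else 1) := by
    intro t
    rw [orbitDeriv_mul C hCc X hXC hαAC hαBC, hαA, hαB, hchA, hchB]
    have eA : vL⁻¹ * (vL * uL⁻¹ * vL⁻¹ * cA) = uL⁻¹ * (vL⁻¹ * cA) := by group
    have eB : vL⁻¹ * (vL * uL⁻¹ * vL⁻¹ * cB) = uL⁻¹ * (vL⁻¹ * cB) := by group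
    rw [eA, eB]
  -- the fibred translations
  obtain ⟨σb₀, hσb₀⟩ := exists_twistPerm (M := M) v (fun p => if p = p₁ then W else 1)
  obtain ⟨σaL, hσaL⟩ := exists_twistPerm (M := M) uL (fun p => αA p * αB p)
  obtain ⟨σbL, hσbL⟩ := exists_twistPerm (M := M) vL (fun _ => X)
  -- the plain translation
  obtain ⟨pl, hpl⟩ := exists_plainPerm (M := M) π
  have hpl' : ∀ y p m₀, pl y (p, m₀) = (π y * p, (1 : M) * m₀) := fun y p m₀ => by rw [hpl, one_mul]
  -- the commutator blocks of the two active handles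
  have hBlA : ∀ p m₀, (pl (a i₀) * σb₀ * (pl (a i₀))⁻¹ * σb₀⁻¹) (p, m₀) =
      (u * v * u⁻¹ * v⁻¹ * p, ((if p = Pp then W else 1) * (if p = Pm then W else 1)⁻¹) * m₀) := by
    intro p m₀
    rw [twist_comm_apply' (hpl' (a i₀)) hσb₀, ← hu, one_mul, inv_one, mul_one, hPp, hPm]
    have e1 : (u⁻¹ * (v⁻¹ * p) = p₁) ↔ p = v * u * p₁ := by
      constructor
      · intro h; rw [← h]; group
      · intro h; rw [h]; group
    have e2 : (v⁻¹ * p = p₁) ↔ p = v * p₁ := by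
      constructor
      · intro h; rw [← h]; group
      · intro h; rw [h]; group
    simp only [e1, e2]
  have hBlB : ∀ p m₀, (σaL * σbL * σaL⁻¹ * σbL⁻¹) (p, m₀) =
      (uL * vL * uL⁻¹ * vL⁻¹ * p, ((if p = cA then W⁻¹ else 1) * (if p = cB then W else 1)) * m₀) := by
    intro p m₀
    rw [twist_comm_apply hσaL hσbL, hα]
    simp only [mul_left_cancel_iff]
  -- the generator assignment
  let σ : puncturedSurfaceGen g r → Equiv.Perm (Q × M) := fun s =>
    match s with
    | Sum.inl (i, false) => if i = iL then σaL else pl (a i)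
    | Sum.inl (i, true) => if i = i₀ then σb₀ else if i = iL then σbL else pl (b i)
    | Sum.inr j => pl (c j)
  have hσa₀ : σ (Sum.inl (i₀, false)) = pl (a i₀) := by simp [σ, hi₀L]
  have hσb₀' : σ (Sum.inl (i₀, true)) = σb₀ := by simp [σ]
  have hσaL' : σ (Sum.inl (iL, false)) = σaL := by simp [σ]
  have hσbL' : σ (Sum.inl (iL, true)) = σbL := by simp [σ, hi₀L.symm]
  have hσa : ∀ i, i ≠ i₀ → i ≠ iL → σ (Sum.inl (i, false)) = pl (a i) := fun i _ h2 => by simp [σ, h2]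
  have hσb : ∀ i, i ≠ i₀ → i ≠ iL → σ (Sum.inl (i, true)) = pl (b i) := fun i h1 h2 => by simp [σ, h1, h2]
  -- the blocks
  obtain ⟨Bl, hBl⟩ : ∃ Bl : Fin g → Equiv.Perm (Q × M), ∀ i, Bl i =
      σ (Sum.inl (i, false)) * σ (Sum.inl (i, true)) * (σ (Sum.inl (i, false)))⁻¹ *
        (σ (Sum.inl (i, true)))⁻¹ := ⟨_, fun _ => rfl⟩
  have hBl_plain : ∀ i, i ≠ i₀ → i ≠ iL → Bl i = pl (w i) := by
    intro i h1 h2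
    rw [hBl, hw, hσa i h1 h2, hσb i h1 h2, map_mul, map_mul, map_mul, map_inv, map_inv]
  have hBl₀ : ∀ p m₀, Bl i₀ (p, m₀) =
      (π (w i₀) * p, ((if p = Pp then W else 1) * (if p = Pm then W else 1)⁻¹) * m₀) := by
    intro p m₀
    rw [hBl, hσa₀, hσb₀', hBlA, hπw₀]
  have hBlL : ∀ p m₀, Bl iL (p, m₀) =
      (π (w iL) * p, ((if p = cA then W⁻¹ else 1) * (if p = cB then W else 1)) * m₀) := by
    intro p m₀
    rw [hBl, hσaL', hσbL', hBlB, hπwL]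
  -- padded products of plain blocks are plain
  have hmid_plain :
      ((List.finRange g).map fun i : Fin g =>
          if 1 ≤ (i : ℕ) then (if (i : ℕ) < g - 1 then Bl i else 1) else 1).prod = pl mid := by
    rw [hmid, map_list_prod, List.map_map]
    refine congrArg List.prod (List.map_congr_left fun i _ => ?_)
    change _ = pl (if 1 ≤ (i : ℕ) then (if (i : ℕ) < g - 1 then w i else 1) else 1)
    by_cases h1 : 1 ≤ (i : ℕ)
    · by_cases h2 : (i : ℕ) < g - 1
      · rw [if_pos h1, if_pos h2, if_pos h1, if_pos h2]
        refine hBl_plain i (fun h => ?_) (fun h => ?_)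
        · rw [h, hi₀] at h1; simp at h1
        · rw [h, hiL] at h2; simp at h2
      · rw [if_pos h1, if_neg h2, if_pos h1, if_neg h2, map_one]
    · rw [if_neg h1, if_neg h1, map_one]
  -- the product of all blocks is plain: the two charges of the loop block are cancelled by the handle `g−1`
  have hBl_prod : ((List.finRange g).map Bl).prod = pl (((List.finRange g).map w).prod) := by
    rw [prod_map_finRange_eq_first_mul_mid_mul_last hg Bl, hmid_plain, hw_split, map_mul, map_mul]
    refine Equiv.ext fun z => ?_
    obtain ⟨p, m₀⟩ := z
    rw [Equiv.Perm.mul_apply, Equiv.Perm.mul_apply, Equiv.Perm.mul_apply, Equiv.Perm.mul_apply,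
      hBlL, hpl, hBl₀, hpl, hpl, hpl]
    refine Prod.ext rfl ?_
    change ((if π mid * (π (w iL) * p) = Pp then W else 1) * (if π mid * (π (w iL) * p) = Pm then W else 1)⁻¹) *
      (((if p = cA then W⁻¹ else 1) * (if p = cB then W else 1)) * m₀) = m₀
    have hiffA : π mid * (π (w iL) * p) = Pp ↔ p = cA := by
      rw [hcA, eq_inv_mul_iff_mul_eq, map_mul, mul_assoc]
    have hiffB : π mid * (π (w iL) * p) = Pm ↔ p = cB := by
      rw [hcB, eq_inv_mul_iff_mul_eq, map_mul, mul_assoc]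
    have hWc : ∀ y : M, y * W = W * y := fun y => Subgroup.mem_center_iff.mp (Subgroup.pow_mem _ hZ L) y
    by_cases hpA : p = cA
    · by_cases hpB : p = cB
      · rw [if_pos (hiffA.mpr hpA), if_pos (hiffB.mpr hpB), if_pos hpA, if_pos hpB]; group
      · rw [if_pos (hiffA.mpr hpA), if_neg (fun h => hpB (hiffB.mp h)), if_pos hpA, if_neg hpB]; group
    · by_cases hpB : p = cB
      · rw [if_neg (fun h => hpA (hiffA.mp h)), if_pos (hiffB.mpr hpB), if_neg hpA, if_pos hpB]; group
      · rw [if_neg (fun h => hpA (hiffA.mp h)), if_neg (fun h => hpB (hiffB.mp h)), if_neg hpA, if_neg hpB]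
        group
  -- the relator acts trivially
  have hrel : ∀ R ∈ ({relator g r} : Set (FreeGroup (puncturedSurfaceGen g r))),
      FreeGroup.lift σ R = 1 := by
    intro R hR
    rw [Set.mem_singleton_iff] at hR
    rw [hR, lift_relator]
    have h1 : (fun i : Fin g => σ (Sum.inl (i, false)) * σ (Sum.inl (i, true)) *
        (σ (Sum.inl (i, false)))⁻¹ * (σ (Sum.inl (i, true)))⁻¹) = Bl := funext fun i => (hBl i).symm
    have h2 : ((List.finRange r).map fun j => σ (Sum.inr j)).prod =
        pl (((List.finRange r).map fun j : Fin r => c (g := g) j).prod) := by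
      rw [map_list_prod, List.map_map]; rfl
    rw [h1, hBl_prod, h2, ← map_mul, hwc, map_one]
  -- the action
  let ρ : PuncturedSurfaceGroup g r →* Equiv.Perm (Q × M) := PresentedGroup.toGroup hrel
  have hρ_of : ∀ s, ρ (PresentedGroup.of s) = σ s := fun s => PresentedGroup.toGroup.of hrel
  -- every `ρ γ` is a fibred translation over `π γ`
  have hfib : ∀ γ : PuncturedSurfaceGroup g r, ∃ κ : Q → M, ∀ p m₀, ρ γ (p, m₀) = (π γ * p, κ p * m₀) := by
    refine fibred_of_generators ρ π fun s => ?_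
    rw [hρ_of]
    rcases s with ⟨i, _ | _⟩ | j
    · by_cases h2 : i = iL
      · subst h2; exact ⟨fun p => αA p * αB p, by rw [hσaL']; exact hσaL⟩
      · refine ⟨fun _ => 1, ?_⟩
        have : σ (Sum.inl (i, false)) = pl (a i) := by simp [σ, h2]
        rw [this]; exact hpl' _
    · by_cases h1 : i = i₀
      · subst h1; exact ⟨_, by rw [hσb₀']; exact hσb₀⟩
      · by_cases h2 : i = iL
        · subst h2; exact ⟨fun _ => X, by rw [hσbL']; exact hσbL⟩
        · exact ⟨fun _ => 1, by rw [hσb i h1 h2]; exact hpl' _⟩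
    · exact ⟨fun _ => 1, hpl' _⟩
  -- `ρ x` is the `W`-twist of `b_0` supported at `p₁`
  have hρx : ∀ p m₀, ρ x (p, m₀) = (π x * p, (if p = p₁ then W else 1) * m₀) := by
    intro p m₀
    have h1 : ρ x = σb₀ := by rw [hxdef]; exact (hρ_of _).trans hσb₀'
    rw [h1, hσb₀]
  -- powers of `ρ x`: plain along `⟨π x⟩`-orbits missing `p₁`, charge `W^e` at `p₁`
  have hK1 := fun (p : Q) (hp : ∀ i : ℕ, π x ^ i * p ≠ p₁) => twist_pow_apply_of_forall_ne hρx p hp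
  have hK2 := twist_pow_apply_self hρx
  -- the character of the fibre over `1`
  obtain ⟨z₁, hz₁⟩ : ∃ z₁ : Q × M, z₁ = (1, 1) := ⟨_, rfl⟩
  have hρN : ∀ {n : PuncturedSurfaceGroup g r}, n ∈ N → (ρ n z₁).1 = 1 := fun {n} hn => by
    obtain ⟨κ, hκ⟩ := hfib n
    rw [hz₁, hκ, hπN.mpr hn, one_mul]
  have hρ_snd : ∀ (γ : PuncturedSurfaceGroup g r) (p : Q) (m₀ m' : M),
      ρ γ (p, m₀ * m') = ((ρ γ (p, m₀)).1, (ρ γ (p, m₀)).2 * m') := fun γ p m₀ m' => by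
    obtain ⟨κ, hκ⟩ := hfib γ
    rw [hκ, hκ, mul_assoc]
  let ψ : N →* M :=
    { toFun := fun n => (ρ (n : PuncturedSurfaceGroup g r) z₁).2
      map_one' := by
        change (ρ ((1 : N) : PuncturedSurfaceGroup g r) z₁).2 = 1
        rw [OneMemClass.coe_one, map_one, Equiv.Perm.one_apply, hz₁]
      map_mul' := fun n n' => by
        change (ρ ((n : PuncturedSurfaceGroup g r) * n') z₁).2 =
          (ρ (n : PuncturedSurfaceGroup g r) z₁).2 * (ρ (n' : PuncturedSurfaceGroup g r) z₁).2
        have h := hρ_snd (n : PuncturedSurfaceGroup g r) 1 1 (ρ (n' : PuncturedSurfaceGroup g r) z₁).2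
        rw [one_mul, ← hz₁] at h
        have hn' : ρ (n' : PuncturedSurfaceGroup g r) z₁ = (1, (ρ (n' : PuncturedSurfaceGroup g r) z₁).2) :=
          Prod.ext (hρN n'.2) rfl
        rw [map_mul ρ, Equiv.Perm.mul_apply, hn', h] }
  have hψ : ∀ (n : PuncturedSurfaceGroup g r) (hn : n ∈ N), ψ ⟨n, hn⟩ = (ρ n z₁).2 := fun _ _ => rfl
  -- evaluation on a level conjugate `f y f⁻¹` of an element `y` FIXING the fibre over `π f⁻¹` pointwise …
  have heval_fix : ∀ (f y : PuncturedSurfaceGroup g r) (hy : f * y * f⁻¹ ∈ N),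
      (∀ m₀, ρ y (π f⁻¹, m₀) = (π f⁻¹, m₀)) → ψ ⟨f * y * f⁻¹, hy⟩ = 1 := by
    intro f y hy hfix
    rw [hψ, map_mul ρ, map_mul ρ, Equiv.Perm.mul_apply, Equiv.Perm.mul_apply]
    obtain ⟨κ, hκ⟩ := hfib f⁻¹
    have h0 : ρ f⁻¹ z₁ = (π f⁻¹, κ 1) := by rw [hz₁, hκ, mul_one, mul_one]
    rw [h0, hfix, ← h0, ← Equiv.Perm.mul_apply, ← map_mul, mul_inv_cancel, map_one,
      Equiv.Perm.one_apply, hz₁]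
  -- … or MULTIPLYING the fibre over `π f⁻¹` by `W^e`
  have heval_pow : ∀ (f y : PuncturedSurfaceGroup g r) (hy : f * y * f⁻¹ ∈ N) (e : ℕ),
      (∀ m₀, ρ y (π f⁻¹, m₀) = (π f⁻¹, W ^ e * m₀)) →
        ∃ t : M, ψ ⟨f * y * f⁻¹, hy⟩ = t⁻¹ * W ^ e * t := by
    intro f y hy e hmul
    obtain ⟨κ, hκ⟩ := hfib f⁻¹
    obtain ⟨κ', hκ'⟩ := hfib f
    have h0 : ρ f⁻¹ z₁ = (π f⁻¹, κ 1) := by rw [hz₁, hκ, mul_one, mul_one]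
    have h1 : ρ f (π f⁻¹, κ 1) = z₁ := by
      rw [← h0, ← Equiv.Perm.mul_apply, ← map_mul, mul_inv_cancel, map_one, Equiv.Perm.one_apply]
    have h2 : κ' (π f⁻¹) * κ 1 = 1 := by
      have h := h1; rw [hκ', hz₁] at h; exact (Prod.mk.inj h).2
    refine ⟨κ 1, ?_⟩
    rw [hψ, map_mul ρ, map_mul ρ, Equiv.Perm.mul_apply, Equiv.Perm.mul_apply, h0, hmul, hκ',
      ← mul_assoc, eq_inv_of_mul_eq_one_left h2]
  refine ⟨ψ, ?_, ?_⟩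
  · -- ALIVE: the level node of `f₁`
    obtain ⟨e, he1, he2, he⟩ := hK2 m
    have hxm : π x ^ m * p₁ = p₁ := by
      rw [← map_pow, hπN.mpr (Subgroup.pow_index_mem N x), one_mul]
    have hmul : ∀ m₀, ρ (x ^ m) (π f₁⁻¹, m₀) = (π f₁⁻¹, W ^ e * m₀) := fun m₀ => by
      rw [map_pow, ← hp₁, he m₀, hxm]
    obtain ⟨t, ht⟩ := heval_pow f₁ (x ^ m) (hN.conj_mem _ (Subgroup.pow_index_mem N x) f₁) e hmul
    rw [ht]
    intro h0
    have hWe : W ^ e = 1 := by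
      rw [show W ^ e = t * (t⁻¹ * W ^ e * t) * t⁻¹ by group, h0]; group
    rw [hW, ← pow_mul, hZq] at hWe
    have hle : q ≤ L * e := Nat.le_of_dvd (Nat.mul_pos hL_pos (he1 hmpos)) hWe
    have hle' : L * e ≤ m ^ 3 := by
      calc L * e ≤ m * m := Nat.mul_le_mul hL_le he2
        _ ≤ m * m * m := Nat.le_mul_of_pos_right _ hmpos
        _ = m ^ 3 := by ring
    omega
  · -- KILL: every other level node
    intro f₂ hf₂ z hz
    obtain ⟨hz1, hz2⟩ := Subgroup.mem_inf.mp hz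
    obtain ⟨y, hy, hyz⟩ := (Subgroup.mem_smul_pointwise_iff_exists _ _ _).mp hz1
    have hz' : z = f₂ * y * f₂⁻¹ := by rw [← hyz, ConjAct.smul_def, ConjAct.ofConjAct_toConjAct]
    have hz2' : f₂ * y * f₂⁻¹ ∈ N := hz' ▸ hz2
    have hsub : (⟨z, hz.2⟩ : N) = ⟨f₂ * y * f₂⁻¹, hz2'⟩ := Subtype.ext hz'
    rw [hsub]
    -- the `⟨π x⟩`-orbit of `π f₂⁻¹` misses `p₁`
    have hmiss : ∀ i : ℕ, π x ^ i * π f₂⁻¹ ≠ p₁ := by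
      intro i hi
      apply hf₂
      rw [hp₁, ← map_pow, ← map_mul, hπ, QuotientGroup.mk'_apply, QuotientGroup.mk'_apply,
        QuotientGroup.eq] at hi
      refine Set.mem_mul.mpr ⟨x ^ i, Subgroup.npow_mem_zpowers x i,
        f₂⁻¹ * ((x ^ i * f₂⁻¹)⁻¹ * f₁⁻¹) * f₂, ?_, by group⟩
      have h := hN.conj_mem _ hi f₂⁻¹
      rwa [inv_inv] at h
    -- natural powers of `x` conjugated into `N` by `f₂` fix the fibre over `π f₂⁻¹` pointwise
    have hynat : ∀ n : ℕ, f₂ * x ^ n * f₂⁻¹ ∈ N → ∀ m₀, ρ (x ^ n) (π f₂⁻¹, m₀) = (π f₂⁻¹, m₀) := by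
      intro n hn m₀
      have hxn : x ^ n ∈ N := by
        have h := hN.conj_mem _ hn f₂⁻¹
        simpa only [inv_inv, mul_assoc, inv_mul_cancel_left, inv_mul_cancel, mul_one] using h
      have h1 : π x ^ n * π f₂⁻¹ = π f₂⁻¹ := by rw [← map_pow, hπN.mpr hxn, one_mul]
      rw [map_pow, hK1 (π f₂⁻¹) hmiss n m₀, h1]
    obtain ⟨k, rfl⟩ := Subgroup.mem_zpowers_iff.mp hy
    rcases Int.eq_nat_or_neg k with ⟨n, rfl | rfl⟩
    · have hn : f₂ * x ^ n * f₂⁻¹ ∈ N := by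
        have h := hz2'
        rwa [zpow_natCast] at h
      exact heval_fix f₂ _ hz2' fun m₀ => by rw [zpow_natCast]; exact hynat n hn m₀
    · have hn : f₂ * x ^ n * f₂⁻¹ ∈ N := by
        have h := N.inv_mem hz2'
        simpa only [mul_inv_rev, inv_inv, zpow_neg, zpow_natCast, mul_assoc] using h
      refine heval_fix f₂ _ hz2' fun m₀ => ?_
      rw [zpow_neg, zpow_natCast, map_inv, Equiv.Perm.inv_def, Equiv.symm_apply_eq]
      exact (hynat n hn m₀).symm


end PuncturedSurfaceGroup

end Literature.GroupTheory.CombinatorialGroupTheory
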